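import Literature.Topology.FourManifolds.KnotGroup
import HarnessLib

/-!
# Invariance of the Alexander ideal and polynomial under group isomorphisms

Companion ("proofs") file of `Literature.Topology.FourManifolds.KnotGroup` and
`Literature.Topology.FourManifolds.AlexanderModule`: discharge of the named fact
`Literature.Topology.FourManifolds.IsAlexanderPolynomial.of_mulEquiv` — if `G ≃* H`, then `G` and
`H` have the same Alexander polynomials. The statement is transport of structure; the file
proves it as reusable, definition-free API.

## Content

* `Literature.Topology.FourManifolds.Module.map_fittingIdeal_of_semilinear`: the `0`-th Fitting
  ideal (`Module.fittingIdeal`, intrinsic form: determinants of square relation matrices of finite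
  generating families) is invariant under additive isomorphisms `A ≃+ B` that are semilinear over
  a ring isomorphism `σ : R ≃+* S` — `σ` maps `Fitt₀(A)` onto `Fitt₀(B)` (Eisenbud, *Commutative
  Algebra*, §20.2; the counterpart of Crowell–Fox Ch. VII (4.5), invariance of the elementary
  ideals under presentation equivalence).
* `Literature.Topology.FourManifolds.exists_commutator_mulEquiv`,
  `Literature.Topology.FourManifolds.conjRep_mulEquiv`,
  `Literature.Topology.FourManifolds.exists_alexanderModule_addEquiv`: a group isomorphism
  `φ : G ≃* H` restricts to `G' ≃* H'`, intertwines the conjugation representations, and induces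
  an additive isomorphism of Alexander modules `G'/G'' ≃+ H'/H''` that is semilinear over the
  group-ring isomorphism `ℤ[φᵃᵇ] : ℤ[Gᵃᵇ] ≃+* ℤ[Hᵃᵇ]`
  (`MonoidAlgebra.mapDomainRingEquiv ℤ φ.abelianizationCongr`).
* `Literature.Topology.FourManifolds.map_alexanderIdeal_of_mulEquiv`: hence `ℤ[φᵃᵇ]` carries the
  Alexander ideal of `G` onto that of `H` (Crowell–Fox Ch. VII (4.6): "the elementary ideals are
  invariants of any finitely presented group").
* `Literature.Topology.FourManifolds.IsAlexanderPolynomial.of_mulEquiv_holds`: the discharge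
  (Crowell–Fox Ch. VIII (3.4), "Invariance of the knot polynomials": re-choose the identification
  `Hᵃᵇ ≃* ℤ` as `e ∘ (φᵃᵇ)⁻¹`).

## Sources

R. H. Crowell, R. H. Fox, *Introduction to Knot Theory* (Ginn 1963; Springer GTM 57, 1977 —
same numbering), Ch. VII (4.5)–(4.6), Ch. VIII (3.4). (In that numbering Ch. VIII (3.5), the
locator quoted in the fact's docstring, is the neighbouring statement `E₀ = Δ₀ = 0`.)
D. Eisenbud, *Commutative Algebra with a View Toward Algebraic Geometry* (1995), §20.2.
D. Rolfsen, *Knots and Links* (1976), §7.C.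

## Design

No definitions are introduced: the restricted isomorphism `G' ≃* H'` and the isomorphism of
Alexander modules are produced as existential statements (`exists_commutator_mulEquiv`,
`exists_alexanderModule_addEquiv`) and the intertwining lemmas are stated for any
`E : G' ≃* H'` over `φ` (hypothesis `hE : ∀ g, (E g : H) = φ g`).
-/

noncomputable section

open scoped LaurentPolynomial

namespace Literature.Topology.FourManifolds

universe u

/-! ## Transport of the Fitting ideal along a semilinear isomorphism -/

section FittingTransport

variable {R S A B : Type*} [CommRing R] [CommRing S] [AddCommGroup A] [Module R A]
  [AddCommGroup B] [Module S B]

/-- A `σ`-semilinear additive isomorphism `f : A ≃+ B` over a ring isomorphism `σ : R ≃+* S`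
carries generating families of the `R`-module `A` to generating families of the `S`-module `B`.
[folklore] -/
theorem Module.span_range_comp_eq_top_of_semilinear (σ : R ≃+* S) (f : A ≃+ B)
    (hf : ∀ (r : R) (a : A), f (r • a) = σ r • f a) {ι : Type*} {x : ι → A}
    (hx : Submodule.span R (Set.range x) = ⊤) :
    Submodule.span S (Set.range (f ∘ x)) = ⊤ := by
  rw [eq_top_iff]
  rintro b -
  obtain ⟨a, rfl⟩ := f.surjective b
  have ha : a ∈ Submodule.span R (Set.range x) := hx ▸ Submodule.mem_top
  induction ha using Submodule.span_induction with
  | mem y hy =>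
    obtain ⟨i, rfl⟩ := hy
    exact Submodule.subset_span ⟨i, rfl⟩
  | zero => rw [map_zero]; exact Submodule.zero_mem _
  | add y z _ _ hy hz => rw [map_add]; exact Submodule.add_mem _ hy hz
  | smul r y _ hy => rw [hf]; exact Submodule.smul_mem _ _ hy

/-- One inclusion of the transport of Fitting ideals: a `σ`-semilinear additive isomorphism
`f : A ≃+ B` over `σ : R ≃+* S` maps the `0`-th Fitting ideal of `A` into that of `B` (a square
relation matrix `a` among generators `x` of `A` gives the relation matrix `σ ∘ a` among the
generators `f ∘ x` of `B`, and `σ (det a) = det (σ ∘ a)`). Eisenbud, *Commutative Algebra*,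
§20.2; Crowell–Fox (1963), Ch. VII (4.5). [folklore] -/
theorem Module.map_fittingIdeal_le_of_semilinear (σ : R ≃+* S) (f : A ≃+ B)
    (hf : ∀ (r : R) (a : A), f (r • a) = σ r • f a) :
    (Module.fittingIdeal R A).map σ ≤ Module.fittingIdeal S B := by
  rw [Module.fittingIdeal, Ideal.map_span, Ideal.span_le]
  rintro _ ⟨d, ⟨n, x, a, hx, ha, rfl⟩, rfl⟩
  refine Ideal.subset_span ⟨n, f ∘ x, a.map σ, ?_, fun i => ?_, ?_⟩
  · exact Module.span_range_comp_eq_top_of_semilinear σ f hf hx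
  · have h := congrArg f (ha i)
    rw [map_sum, map_zero] at h
    simpa only [Function.comp_apply, Matrix.map_apply, hf] using h
  · exact σ.map_det a

/-- **Fitting ideals are invariant under semilinear isomorphisms**: if `f : A ≃+ B` is additive
and `σ`-semilinear over a ring isomorphism `σ : R ≃+* S` (`f (r • a) = σ r • f a`), then `σ`
carries the `0`-th Fitting ideal of the `R`-module `A` onto that of the `S`-module `B`.
Eisenbud, *Commutative Algebra*, §20.2; Crowell–Fox (1963), Ch. VII (4.5)–(4.6). [folklore] -/
theorem Module.map_fittingIdeal_of_semilinear (σ : R ≃+* S) (f : A ≃+ B)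
    (hf : ∀ (r : R) (a : A), f (r • a) = σ r • f a) :
    (Module.fittingIdeal R A).map σ = Module.fittingIdeal S B := by
  refine le_antisymm (Module.map_fittingIdeal_le_of_semilinear σ f hf) ?_
  have hf' : ∀ (s : S) (b : B), f.symm (s • b) = σ.symm s • f.symm b := fun s b => by
    apply f.injective
    rw [f.apply_symm_apply, hf, σ.apply_symm_apply, f.apply_symm_apply]
  calc Module.fittingIdeal S B
      = ((Module.fittingIdeal S B).map σ.symm).map σ := by
        rw [← Ideal.map_coe σ.symm, ← Ideal.map_coe σ]
        exact (Ideal.map_of_equiv (I := Module.fittingIdeal S B) σ.symm).symm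
    _ ≤ (Module.fittingIdeal R A).map σ :=
        Ideal.map_mono (Module.map_fittingIdeal_le_of_semilinear σ.symm f.symm hf')

end FittingTransport

/-! ## Functoriality of the Alexander module and ideal under group isomorphisms -/

section AlexanderFunctorial

variable {G H : Type*} [Group G] [Group H] (φ : G ≃* H)

/-- A group isomorphism maps the commutator subgroup onto the commutator subgroup. [folklore] -/
theorem map_commutator_eq_of_mulEquiv : (commutator G).map (φ : G →* H) = commutator H := by
  rw [commutator_def, commutator_def, Subgroup.map_commutator, ← MonoidHom.range_eq_map,
    MonoidHom.range_eq_top.mpr φ.surjective]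

/-- A group isomorphism `φ : G ≃* H` restricts to an isomorphism `G' ≃* H'` of commutator
subgroups (Mathlib's `MulEquiv.subgroupMap` followed by `MulEquiv.subgroupCongr`). [folklore] -/
theorem exists_commutator_mulEquiv :
    ∃ E : commutator G ≃* commutator H, ∀ g : commutator G, (E g : H) = φ g :=
  ⟨(φ.subgroupMap (commutator G)).trans (MulEquiv.subgroupCongr (map_commutator_eq_of_mulEquiv φ)),
    fun _ => rfl⟩

variable {φ} {E : commutator G ≃* commutator H}

/-- An isomorphism `E : G' ≃* H'` over `φ : G ≃* H` intertwines conjugation by `g` on `G'` with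
conjugation by `φ g` on `H'`. [folklore] -/
theorem conjNormal_mulEquiv (hE : ∀ g : commutator G, (E g : H) = φ g) (g : G)
    (h : commutator G) : E (MulAut.conjNormal g h) = MulAut.conjNormal (φ g) (E h) := by
  apply Subtype.ext
  simp only [hE, MulAut.conjNormal_apply, map_mul, map_inv]

/-- The isomorphism `(G')ᵃᵇ ≃* (H')ᵃᵇ` induced by an isomorphism `E : G' ≃* H'` over `φ : G ≃* H`
intertwines the conjugation representations `conjRep G` and `conjRep H` along
`φᵃᵇ : Gᵃᵇ ≃* Hᵃᵇ` (Crowell–Fox Ch. VIII §3: the induced isomorphism of group rings is compatible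
with the module structures). [folklore] -/
theorem conjRep_mulEquiv (hE : ∀ g : commutator G, (E g : H) = φ g) (a : Abelianization G)
    (m : Abelianization (commutator G)) :
    E.abelianizationCongr (conjRep G a m) =
      conjRep H (φ.abelianizationCongr a) (E.abelianizationCongr m) := by
  induction a using QuotientGroup.induction_on with
  | H g =>
    induction m using QuotientGroup.induction_on with
    | H h =>
      change E.abelianizationCongr (conjRep G (Abelianization.of g) (Abelianization.of h)) =
        conjRep H (φ.abelianizationCongr (Abelianization.of g))
          (E.abelianizationCongr (Abelianization.of h))
      simp only [conjRep_of, conjAbelianization_apply_of, abelianizationCongr_of,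
        conjNormal_mulEquiv hE]

/-- Additive form of `conjRep_mulEquiv`: the additive isomorphism
`Additive (G')ᵃᵇ ≃+ Additive (H')ᵃᵇ` induced by `E` intertwines the Alexander representations of
`Gᵃᵇ` and `Hᵃᵇ` along `φᵃᵇ`. [folklore] -/
theorem alexanderRep_mulEquiv (hE : ∀ g : commutator G, (E g : H) = φ g) (a : Abelianization G)
    (v : Additive (Abelianization (commutator G))) :
    MulEquiv.toAdditive E.abelianizationCongr (alexanderRep G a v) =
      alexanderRep H (φ.abelianizationCongr a) (MulEquiv.toAdditive E.abelianizationCongr v) :=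
  congrArg Additive.ofMul (conjRep_mulEquiv hE a v.toMul)

variable (φ)

/-- The **Alexander module is functorial under group isomorphisms**: `φ : G ≃* H` induces an
additive isomorphism `G'/G'' ≃+ H'/H''` of Alexander modules which is semilinear over the
group-ring isomorphism `ℤ[φᵃᵇ] : ℤ[Gᵃᵇ] ≃+* ℤ[Hᵃᵇ]` (`MonoidAlgebra.mapDomainRingEquiv`); it is
the abelianization of `φ|G' : G' ≃* H'` transported along `Additive`. Crowell–Fox (1963),
Ch. VII (4.6), Ch. VIII §3; Rolfsen (1976), §7.C. [folklore] -/
theorem exists_alexanderModule_addEquiv :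
    ∃ f : alexanderModule G ≃+ alexanderModule H,
      ∀ (r : MonoidAlgebra ℤ (Abelianization G)) (x : alexanderModule G),
        f (r • x) = MonoidAlgebra.mapDomainRingEquiv ℤ φ.abelianizationCongr r • f x := by
  obtain ⟨E, hE⟩ := exists_commutator_mulEquiv φ
  refine ⟨(alexanderRep G).asModuleEquiv.toAddEquiv.trans
    ((MulEquiv.toAdditive E.abelianizationCongr).trans
      (alexanderRep H).asModuleEquiv.toAddEquiv.symm), fun r x => ?_⟩
  induction r using MonoidAlgebra.induction_linear with
  | zero => rw [zero_smul, map_zero, map_zero, zero_smul]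
  | add r s hr hs => rw [add_smul, map_add, hr, hs, map_add, add_smul]
  | single a n =>
    rw [MonoidAlgebra.mapDomainRingEquiv_single, Representation.single_smul,
      Representation.single_smul]
    change MulEquiv.toAdditive E.abelianizationCongr
        (n • alexanderRep G a ((alexanderRep G).asModuleEquiv x)) =
      n • alexanderRep H (φ.abelianizationCongr a)
        (MulEquiv.toAdditive E.abelianizationCongr ((alexanderRep G).asModuleEquiv x))
    rw [map_zsmul, alexanderRep_mulEquiv hE]

/-- The **Alexander ideal is functorial under group isomorphisms**: the group-ring isomorphism
`ℤ[Gᵃᵇ] ≃+* ℤ[Hᵃᵇ]` induced by `φ : G ≃* H` carries the Alexander ideal of `G` onto that of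
`H` (transport of the Fitting ideal along the semilinear isomorphism of Alexander modules,
`exists_alexanderModule_addEquiv` and `Module.map_fittingIdeal_of_semilinear`). Crowell–Fox
(1963), Ch. VII (4.5)–(4.6) ("the elementary ideals are invariants of any finitely presented
group"). [cite: CrowellFox1963, Ch. VII (4.5)–(4.6)] -/
theorem map_alexanderIdeal_of_mulEquiv :
    (alexanderIdeal G).map (MonoidAlgebra.mapDomainRingEquiv ℤ φ.abelianizationCongr) =
      alexanderIdeal H := by
  obtain ⟨f, hf⟩ := exists_alexanderModule_addEquiv φ
  exact Module.map_fittingIdeal_of_semilinear _ f hf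

/-- Changing the identification `Gᵃᵇ ≃* Hᵃᵇ ≃* ℤ`: composing the group-ring isomorphism
`ℤ[ψ] : ℤ[Gᵃᵇ] ≃+* ℤ[Hᵃᵇ]` with `laurentEquivOfMulEquiv H e'` is
`laurentEquivOfMulEquiv G (ψ ≫ e')`. [folklore] -/
theorem mapDomainRingEquiv_trans_laurentEquivOfMulEquiv (ψ : Abelianization G ≃* Abelianization H)
    (e' : Abelianization H ≃* Multiplicative ℤ) :
    (MonoidAlgebra.mapDomainRingEquiv ℤ ψ).trans (laurentEquivOfMulEquiv H e') =
      laurentEquivOfMulEquiv G (ψ.trans e') := by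
  rw [laurentEquivOfMulEquiv, laurentEquivOfMulEquiv, MonoidAlgebra.mapDomainRingEquiv_trans]
  rfl

end AlexanderFunctorial

/-- Unconditional form of `isAlexanderPolynomial_congr` (`KnotGroup`): isomorphic groups have the
same Alexander polynomials. Crowell–Fox (1963), Ch. VIII (3.4).
[cite: CrowellFox1963, Ch. VIII (3.4)] -/
theorem IsAlexanderPolynomial.of_mulEquiv' {G H : Type*} [Group G] [Group H] {Δ : ℤ[T;T⁻¹]}
    (h : IsAlexanderPolynomial G Δ) (φ : G ≃* H) : IsAlexanderPolynomial H Δ := by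
  obtain ⟨e, he⟩ := h
  refine ⟨φ.abelianizationCongr.symm.trans e, ?_⟩
  rw [← map_alexanderIdeal_of_mulEquiv φ, ← Ideal.map_coe (MonoidAlgebra.mapDomainRingEquiv ℤ _),
    ← Ideal.map_coe (laurentEquivOfMulEquiv H _), Ideal.map_map, ← RingEquiv.coe_ringHom_trans,
    mapDomainRingEquiv_trans_laurentEquivOfMulEquiv, Ideal.map_coe]
  convert he
  ext x
  simp only [MulEquiv.trans_apply, MulEquiv.symm_apply_apply]

/-- **Discharge** of the named fact `IsAlexanderPolynomial.of_mulEquiv` (`KnotGroup`): being an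
Alexander polynomial of a group is invariant under group isomorphisms. Given `φ : G ≃* H` and
`e : Gᵃᵇ ≃* ℤ` with `e(𝔄(G)) = (Δ)`, take `e' := e ∘ (φᵃᵇ)⁻¹ : Hᵃᵇ ≃* ℤ`; then
`e'(𝔄(H)) = e'(ℤ[φᵃᵇ] 𝔄(G)) = e(𝔄(G)) = (Δ)` by functoriality of the Alexander ideal
(`map_alexanderIdeal_of_mulEquiv`). This is the argument of Crowell–Fox (1963), Ch. VIII (3.4)
("Invariance of the knot polynomials") on top of Ch. VII (4.5)–(4.6) ("the elementary ideals are
invariants of the group"); in that numbering Ch. VIII (3.5), quoted in the fact's docstring, is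
the neighbouring statement `E₀ = Δ₀ = 0`. Real proof, for `G`, `H` in any common universe.
[cite: CrowellFox1963, Ch. VIII (3.4); Ch. VII (4.5)–(4.6)] -/
theorem IsAlexanderPolynomial.of_mulEquiv_holds : IsAlexanderPolynomial.of_mulEquiv.{u} :=
  fun _ _ _ _ _ hG φ => hG.of_mulEquiv' φ

end Literature.Topology.FourManifolds
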